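import Summits.MatrixMultiplication.OmegaCensus.STPPZoo313Theorem
import Summits.MatrixMultiplication.OmegaCensus.STPPCell22Stage0

/-!
# ω-census (abelian STPP census): cell-(2,2) soundness, step S1 — affine normal form of a two-above `(3,13)` pair at `p = 61` (tool file)

HONEST FRAMING (pub-omega census; verbatim): lottery ticket; floor = certified bounds/negative ranges.
Census STRUCTURE (seat pub-omega-stpp-1 gen 33, 2026-08-29), family (b2).  Step S1 of the cell-(2,2) law (plan HOME `pub-omega-stpp-1-g33/FIFTH-LEAF.md`
§SOUNDNESS): if `#S = 3`, `#Y = 13`, `#(S + Y) = 17` in `ℤ/61` then, MODULO the zoo root row `hrows` (being certified: `STPPZoo313Rows*/Nodes*`), some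
affine map `x ↦ u x + t` (`u ≠ 0`) sends `S` onto `{0, 1, y₀}` with `y₀ ∈ {2, 3, 4}` (`three_set_affine_nf`).  Ingredients: the zoo theorem
`zoo313_61_of_rows`, the kernel row `zooTbl61_ys` (the 14 occurring `y`), an explicit 14-entry affine table (`aff14`, each entry by `decide`), the
translation lemma `exists_mem_sub_not_mem`, and `image_affine_add` (affine images of sumsets).  No `sorry`; `decide` only on 3-point sets of `ZMod 61`.
Nothing here is progress on `ω`.

References: H. Cohn, R. Kleinberg, B. Szegedy, C. Umans, FOCS 2005, Def. 5.1 (the use); M. B. Nathanson, Additive Number Theory: Inverse Problems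
(1996), §2.1 (affine normalisation of small sets).
-/

namespace Summit.MatrixMultiplication.OmegaCensus.CubeNB.S2

open Finset Summit.MatrixMultiplication.OmegaCensus.CubeNB.Bits
open scoped Pointwise

/-! ## §1 Two general lemmas -/

/-- **A proper nonempty subset of `ℤ/p` is not closed under a nonzero translation**: some `s ∈ S` has `s − d ∉ S`. [folklore] -/
theorem exists_mem_sub_not_mem {p : ℕ} [Fact p.Prime] {S : Finset (ZMod p)} (hne : S.Nonempty) (hS : S ≠ univ) {d : ZMod p} (hd : d ≠ 0) :
    ∃ s ∈ S, s - d ∉ S := by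
  by_contra h
  push Not at h
  obtain ⟨s₀, hs₀⟩ := hne
  have hall : ∀ n : ℕ, s₀ - (n : ZMod p) * d ∈ S := by
    intro n
    induction n with
    | zero => simpa using hs₀
    | succ n ih =>
      have := h _ ih
      convert this using 1
      push_cast; ring
  apply hS
  refine eq_univ_of_forall fun x => ?_
  have hx := hall ((s₀ - x) * d⁻¹).val
  rwa [ZMod.natCast_zmod_val, mul_assoc, inv_mul_cancel₀ hd, mul_one, sub_sub_cancel] at hx

/-- **Affine images of sumsets**: `u·(A + B) + (a + b) = (u·A + a) + (u·B + b)`. [folklore] -/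
theorem image_affine_add {R : Type*} [CommRing R] [DecidableEq R] (A B : Finset R) (u a b : R) :
    (A + B).image (fun x => u * x + (a + b)) = A.image (fun x => u * x + a) + B.image (fun x => u * x + b) := by
  ext v
  simp only [mem_image, mem_add]
  constructor
  · rintro ⟨x, ⟨y, hy, z, hz, rfl⟩, rfl⟩
    exact ⟨u * y + a, ⟨y, hy, rfl⟩, u * z + b, ⟨z, hz, rfl⟩, by ring⟩
  · rintro ⟨_, ⟨y, hy, rfl⟩, _, ⟨z, hz, rfl⟩, rfl⟩
    exact ⟨y + z, ⟨y, hy, z, hz, rfl⟩, by ring⟩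

/-! ## §2 The affine table of the 14 occurring `y` -/

/-- **Affine table**: every `y₁ ∈ ys14` has an affine map sending `{0, 1, y₁}` onto `{0, 1, y₀}` with `y₀ ∈ {2, 3, 4}` (explicit witnesses,
checked by `decide`). [folklore] -/
theorem aff14 : ∀ y₁ ∈ ys14, ∃ u₁ t₁ : ZMod 61, u₁ ≠ 0 ∧ ∃ y₀ : ℕ, (y₀ = 2 ∨ y₀ = 3 ∨ y₀ = 4) ∧
    (({0, 1, ((y₁ : ℕ) : ZMod 61)} : Finset (ZMod 61)).image (fun x => u₁ * x + t₁)) = {0, 1, ((y₀ : ℕ) : ZMod 61)} := by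
  intro y₁ hy₁
  simp only [ys14, List.mem_cons, List.not_mem_nil, or_false] at hy₁
  rcases hy₁ with rfl | rfl | rfl | rfl | rfl | rfl | rfl | rfl | rfl | rfl | rfl | rfl | rfl | rfl
  · exact ⟨1, 0, by decide, 2, by norm_num, by decide⟩
  · exact ⟨1, 0, by decide, 3, by norm_num, by decide⟩
  · exact ⟨1, 0, by decide, 4, by norm_num, by decide⟩
  · exact ⟨57, 4, by decide, 4, by norm_num, by decide⟩
  · exact ⟨3, 1, by decide, 4, by norm_num, by decide⟩
  · exact ⟨58, 3, by decide, 3, by norm_num, by decide⟩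
  · exact ⟨2, 1, by decide, 3, by norm_num, by decide⟩
  · exact ⟨2, 0, by decide, 2, by norm_num, by decide⟩
  · exact ⟨59, 3, by decide, 3, by norm_num, by decide⟩
  · exact ⟨3, 0, by decide, 3, by norm_num, by decide⟩
  · exact ⟨58, 4, by decide, 4, by norm_num, by decide⟩
  · exact ⟨4, 0, by decide, 4, by norm_num, by decide⟩
  · exact ⟨60, 1, by decide, 4, by norm_num, by decide⟩
  · exact ⟨60, 1, by decide, 3, by norm_num, by decide⟩

/-- The row `zooTbl61_ys` at one entry: its `y` is in `ys14`. [folklore] -/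
theorem mem_ys14_of_mem_zooTbl61 {e : ℕ × ℕ} (he : e ∈ zooTbl61) : e.1 ∈ ys14 := by
  have h := zooTbl61_ys
  rw [List.all_eq_true] at h
  have h1 := h e he
  rwa [List.elem_eq_mem, decide_eq_true_eq] at h1

/-! ## §3 The normal form -/

/-- Normalising an ordered triple: `x ↦ (b − a)⁻¹ (x − a)` sends `{a, b, c}` to `{0, 1, (b − a)⁻¹ (c − a)}`. [folklore] -/
theorem image_triple_affine {a b c : ZMod 61} (hab : a ≠ b) :
    ({a, b, c} : Finset (ZMod 61)).image (fun x => (b - a)⁻¹ * x + -((b - a)⁻¹ * a)) = {0, 1, (b - a)⁻¹ * (c - a)} := by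
  haveI : Fact (Nat.Prime 61) := ⟨by norm_num⟩
  have hba : b - a ≠ 0 := sub_ne_zero.2 hab.symm
  rw [image_insert, image_insert, image_singleton]
  congr 1
  · ring
  · congr 1
    · rw [← mul_neg, ← mul_add, ← sub_eq_add_neg, inv_mul_cancel₀ hba]
    · congr 1; ring

/-- **Affine normal form of a two-above `(3,13)` pair at `p = 61`** (modulo the zoo root row): some affine map with nonzero slope sends `S` onto
`{0, 1, y₀}`, `y₀ ∈ {2,3,4}`. [folklore] -/
theorem three_set_affine_nf (hrows : zooGo 61 zooTbl61 12 59 3 0 1 [0] = true) (S Y : Finset (ZMod 61)) (hS : #S = 3) (hY : #Y = 13)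
    (h17 : #(S + Y) = 17) :
    ∃ u t : ZMod 61, u ≠ 0 ∧ ∃ y₀ : ℕ, (y₀ = 2 ∨ y₀ = 3 ∨ y₀ = 4) ∧ S.image (fun x => u * x + t) = {0, 1, ((y₀ : ℕ) : ZMod 61)} := by
  have h61a : ((60 : ℕ) : ZMod 61) = -1 := by decide
  have h61b : (60 : ZMod 61) = -1 := by decide
  haveI : Fact (Nat.Prime 61) := ⟨by norm_num⟩
  obtain ⟨a, b, c, hab, hac, hbc, rfl⟩ := card_eq_three.1 hS
  set u₀ : ZMod 61 := (b - a)⁻¹ with hu₀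
  have hba : b - a ≠ 0 := sub_ne_zero.2 hab.symm
  have hu₀0 : u₀ ≠ 0 := inv_ne_zero hba
  set y' : ZMod 61 := u₀ * (c - a) with hy'
  have himg := image_triple_affine (c := c) hab
  rw [← hu₀, ← hy'] at himg
  by_cases h60 : y' = -1
  · -- `{a,b,c}` is an AP centred at `a`; renormalise from `b`: `x ↦ (a − b)⁻¹ (x − b)` gives `{1, 0, 2}`
    have himg2 := image_triple_affine (c := c) (Ne.symm hab)
    have hc2 : (a - b)⁻¹ * (c - b) = 2 := by
      have e1 : (a - b)⁻¹ = -u₀ := by rw [hu₀, ← inv_neg, neg_sub]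
      rw [e1]
      have e2 : c - b = (c - a) - (b - a) := by ring
      rw [e2, mul_sub, neg_mul, neg_mul, ← hy', h60, hu₀, inv_mul_cancel₀ hba]; ring
    refine ⟨(a - b)⁻¹, -((a - b)⁻¹ * b), inv_ne_zero (sub_ne_zero.2 hab), 2, Or.inl rfl, ?_⟩
    rw [show ({a, b, c} : Finset (ZMod 61)) = {b, a, c} from Finset.insert_comm a b {c}, himg2, hc2]
    simp only [Nat.cast_ofNat]
  · -- generic case: `2 ≤ y'.val ≤ 59`; translate `u₀•Y` so that `0 ∈`, `60 ∉`, and read the zoo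
    have hy0 : y' ≠ 0 := by
      rw [hy']; exact mul_ne_zero hu₀0 (sub_ne_zero.2 (Ne.symm hac))
    have hy1 : y' ≠ 1 := by
      intro h
      apply hbc
      have : u₀ * (c - a) = u₀ * (b - a) := by rw [← hy', h, hu₀, inv_mul_cancel₀ hba]
      have h2 := mul_left_cancel₀ hu₀0 this
      linear_combination -h2
    have hy2 : 2 ≤ y'.val := by
      by_contra hlt
      have : y'.val = 0 ∨ y'.val = 1 := by omega
      rcases this with h | h
      · exact hy0 ((ZMod.val_eq_zero y').1 h)
      · apply hy1
        have := congrArg (fun n : ℕ => (n : ZMod 61)) h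
        simpa [ZMod.natCast_zmod_val] using this
    have hy59 : y'.val ≤ 59 := by
      by_contra hlt
      have h := y'.val_lt
      have : y'.val = 60 := by omega
      apply h60
      have e := congrArg (fun n : ℕ => (n : ZMod 61)) this
      simp only [ZMod.natCast_zmod_val] at e
      rw [e, h61a]
    -- translate `u₀ • Y`
    set Y₀ := Y.image (fun x => u₀ * x) with hY₀
    have hY₀card : #Y₀ = 13 := by rw [hY₀, card_image_of_injective _ (mul_right_injective₀ hu₀0), hY]
    obtain ⟨e, he, he1⟩ := exists_mem_sub_not_mem (S := Y₀) (by rw [← card_pos, hY₀card]; norm_num)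
      (by intro h; have := congrArg card h; rw [hY₀card, card_univ, ZMod.card] at this; norm_num at this) one_ne_zero
    set Y' := Y.image (fun x => u₀ * x + -e) with hY'
    have hY'eq : Y' = Y₀.image (fun x => x + -e) := by rw [hY', hY₀, image_image]; rfl
    have hY'card : #Y' = 13 := by rw [hY'eq, card_image_of_injective _ (add_left_injective _), hY₀card]
    have h0 : (0 : ZMod 61) ∈ Y' := by rw [hY'eq]; exact mem_image.2 ⟨e, he, by ring⟩
    have h60' : (60 : ZMod 61) ∉ Y' := by
      rw [hY'eq]
      intro h
      obtain ⟨x, hx, hxe⟩ := mem_image.1 h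
      apply he1
      have hx' : x = e - 1 := by linear_combination hxe + h61b
      rw [← hx']; exact hx
    have h17' : #(({0, 1, y'} : Finset (ZMod 61)) + Y') = 17 := by
      rw [← himg, hY', show -e = (0 : ZMod 61) + -e by ring]
      rw [show -(u₀ * a) = -(u₀ * a) + 0 - 0 by ring]
      have := image_affine_add ({a, b, c} : Finset (ZMod 61)) Y u₀ (-(u₀ * a)) (-e)
      rw [show -(u₀ * a) + 0 - 0 = -(u₀ * a) by ring, show (0 : ZMod 61) + -e = -e by ring]
      rw [← this, card_image_of_injective _ fun x y hxy => mul_left_cancel₀ hu₀0 (add_right_cancel hxy), h17]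
    have hz := zoo313_61_of_rows hrows Y' y' hY'card h0 h60' hy2 hy59 h17'
    have hys := mem_ys14_of_mem_zooTbl61 hz
    obtain ⟨u₁, t₁, hu₁, y₀, hy₀, himg1⟩ := aff14 _ hys
    rw [ZMod.natCast_zmod_val] at himg1
    refine ⟨u₁ * u₀, u₁ * -(u₀ * a) + t₁, mul_ne_zero hu₁ hu₀0, y₀, hy₀, ?_⟩
    have hfun : ((fun x => u₁ * x + t₁) ∘ fun x => u₀ * x + -(u₀ * a)) = fun x => u₁ * u₀ * x + (u₁ * -(u₀ * a) + t₁) := by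
      funext x; simp only [Function.comp]; ring
    rw [← himg1, ← himg, image_image, hfun]

end Summit.MatrixMultiplication.OmegaCensus.CubeNB.S2
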